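import Summits.CriticalPhenomena.SAWScalingLimit.Theorems.SAWLoopFugacityFlowAvoidanceLimitAnchorDefs
import Mathlib.LinearAlgebra.Matrix.Block

/-!
# Laplace expansions for `det(1 - xA)` and `adj(1 - xA)` along one vertex — helper file 1/5 of stub
`stub_determinantal` of line `symplectic-fermion-anchor` (crux `SAWLoopFugacityFlow.AvoidanceLimit`,
stmt-CriticalPhenomena-10649)

Pure linear algebra for the anchor dictionary `Z_{-2,-1,x} = det / adj (1 - xA)`: for a square
matrix `A` over a commutative ring, a diagonal adjugate entry is the complementary principal minor
(`adjugate_diag`) and an off-diagonal one expands along the deleted index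
(`adjugate_eq_neg_sum`: `adj(A)_{ba} = -Σ_{i ≠ a} A_{ia} adj(A|_{≠a})_{bi}`, Mathlib's convention
`adjugate A i j = det (A.updateRow j (Pi.single i 1))`); specialised to `K_Λ = 1 - x·A_{H|Λ}` for a
graph `H` on `ℤ²` and a finite volume `Λ` this gives the row expansion
`det K_Λ = det K_{Λ∖v} - x Σ_{u∼v} adj(K_Λ)_{uv}` (`det_kmat_eq`) and the first-step expansion
`adj(K_Λ)_{ba} = x Σ_{u∼a} adj(K_{Λ∖a})_{bu}` (`adjugate_kmat_eq`), the matrix halves of the two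
recursions that the dressed SAW satisfies (files `…DeterminantalLoopGas`, `…Determinantal`).
Sources: G. Lawler, *Topics in loop measures and the loop-erased walk*, Probab. Surveys 15 (2018),
Prop. 3.1 [Lawler2018] (adjugate / Green's function); folklore linear algebra. No definitions.
-/

noncomputable section

open scoped BigOperators Topology symmDiff
open Filter Finset
open Literature.Probability.RandomPlanarGeometry Literature.Probability.LatticeModels

namespace Summit.CriticalPhenomena.SAWScalingLimit.Theorems.AvoidanceLimit.Anchor

namespace DetExpansion

-- Local notations only (NO auxiliary definitions): indicator `[u ∼ v]`, `K_Λ = 1 - xA`, degree,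
-- collision-free configurations, weight `x^{|F|}(-2)^{loops}`, `Z_{⟨-2,0,x⟩}` — whichever occur below.
local notation "aind[" H ", " u ", " v "]" =>
  (@ite ℝ (SimpleGraph.Adj H u v) (Classical.propDecidable _) (1 : ℝ) 0)
local notation "K[" H ", " Λ ", " x "]" => ((1 : Matrix Λ Λ ℝ) - x • adjMat H Λ)

/-! ## Linear algebra: Laplace-type expansions of `det` and `adjugate` along one index -/

section LinearAlgebra

open Matrix

variable {n : Type*} [Fintype n] [DecidableEq n] {R : Type*} [CommRing R]

/-- A matrix whose row `a` is the unit vector `e_a` has the determinant of its principal minor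
complementary to `a` (block-triangular determinant). [folklore] -/
theorem det_of_row_eq_single (B : Matrix n n R) (a : n) (hB : B a = Pi.single a 1) :
    B.det = (B.toSquareBlockProp fun i => ¬ i = a).det := by
  rw [Matrix.twoBlockTriangular_det' B (fun i => i = a)]
  · haveI : Subsingleton {i // i = a} := ⟨fun x y => Subtype.ext (x.2.trans y.2.symm)⟩
    rw [@Matrix.det_eq_elem_of_subsingleton _ _ (_) _ _ _ _ ⟨a, rfl⟩]
    simp [Matrix.toSquareBlockProp_def, hB]
  · rintro i rfl j hj
    rw [hB, Pi.single_eq_of_ne hj]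

/-- Exchanging the new values of two updated rows changes the sign of the determinant. [folklore] -/
theorem det_updateRow_updateRow_swap (A : Matrix n n R) {a i : n} (h : i ≠ a) (r s : n → R) :
    ((A.updateRow a r).updateRow i s).det = -((A.updateRow a s).updateRow i r).det := by
  have : (A.updateRow a r).updateRow i s =
      ((A.updateRow a s).updateRow i r).submatrix (Equiv.swap a i) id := by
    ext j k
    simp only [submatrix_apply, id, updateRow_apply]
    by_cases hji : j = i
    · subst hji
      rw [Equiv.swap_apply_right, if_pos rfl, if_neg h.symm, if_pos rfl]
    · by_cases hja : j = a
      · subst hja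
        rw [Equiv.swap_apply_left, if_neg hji, if_pos rfl, if_pos rfl]
      · rw [Equiv.swap_apply_of_ne_of_ne hja hji, if_neg hji, if_neg hja, if_neg hji, if_neg hja]
  rw [this, det_permute, Equiv.Perm.sign_swap h.symm]
  simp

/-- **First-step (Laplace) expansion of an off-diagonal adjugate entry** along the deleted index
`a`: `adj(A)_{ba} = -Σ_{i ≠ a} A_{ia} · adj(A|_{≠ a})_{bi}` (Mathlib's convention
`adjugate A i j = det (A.updateRow j (Pi.single i 1))`). [folklore] -/
theorem adjugate_eq_neg_sum (A : Matrix n n R) {a b : n} (hab : a ≠ b) :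
    A.adjugate b a = -∑ i : {i // ¬ i = a}, A i a *
      (A.toSquareBlockProp fun i => ¬ i = a).adjugate ⟨b, hab.symm⟩ i := by
  rw [adjugate_apply, det_eq_sum_mul_adjugate_col _ a, ← Finset.add_sum_erase _ _ (mem_univ a),
    updateRow_self, Pi.single_eq_of_ne hab, zero_mul, zero_add,
    Finset.sum_subtype (univ.erase a) (p := fun i => ¬ i = a) (by simp), ← sum_neg_distrib]
  refine Finset.sum_congr rfl fun i _ => ?_
  have hi : (i : n) ≠ a := i.2
  rw [updateRow_ne hi, adjugate_apply, adjugate_apply, ← mul_neg, det_updateRow_updateRow_swap _ hi,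
    det_of_row_eq_single _ a]
  · have hX : ((A.updateRow a (Pi.single a 1)).updateRow (↑i) (Pi.single b 1)).toSquareBlockProp
        (fun i => ¬ i = a) =
        (A.toSquareBlockProp fun i => ¬ i = a).updateRow i (Pi.single ⟨b, hab.symm⟩ 1) := by
      ext j k
      simp only [toSquareBlockProp_def, of_apply, updateRow_apply, Subtype.ext_iff]
      by_cases hj : (j : n) = i
      · rw [if_pos hj, if_pos hj]
        by_cases hk : (k : n) = b
        · rw [hk, Pi.single_eq_same, show k = ⟨b, hab.symm⟩ from Subtype.ext hk, Pi.single_eq_same]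
        · rw [Pi.single_eq_of_ne hk, Pi.single_eq_of_ne (fun h => hk (congrArg Subtype.val h))]
      · rw [if_neg hj, if_neg hj, if_neg j.2]
    rw [hX]
  · rw [updateRow_ne (Ne.symm hi), updateRow_self]

/-- **A diagonal adjugate entry is the complementary principal minor.** [folklore] -/
theorem adjugate_diag (A : Matrix n n R) (a : n) :
    A.adjugate a a = (A.toSquareBlockProp fun i => ¬ i = a).det := by
  rw [adjugate_apply, det_of_row_eq_single _ a (updateRow_self)]
  congr 1
  ext j k
  simp only [toSquareBlockProp_def, of_apply, updateRow_ne j.2]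

end LinearAlgebra

/-! ## The matrix `1 - x·A_{H|Λ}` and its one-vertex recursions -/

section FermionMatrix

open Matrix

variable {H : SimpleGraph (Site 2)} {Λ : Finset (Site 2)} {x : ℝ}

/-- The indicator of an edge is `1`. [folklore] -/
theorem aind_of_adj {u v : Site 2} (h : H.Adj u v) : aind[H, u, v] = 1 := if_pos h

/-- The indicator of a non-edge is `0`. [folklore] -/
theorem aind_of_not_adj {u v : Site 2} (h : ¬H.Adj u v) : aind[H, u, v] = 0 := if_neg h

/-- The indicator is symmetric. [folklore] -/
theorem aind_comm (u v : Site 2) : aind[H, u, v] = aind[H, v, u] := by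
  by_cases h : H.Adj u v
  · rw [aind_of_adj h, aind_of_adj h.symm]
  · rw [aind_of_not_adj h, aind_of_not_adj fun h' => h h'.symm]

/-- The indicator vanishes on the diagonal. [folklore] -/
theorem aind_self (u : Site 2) : aind[H, u, u] = 0 := aind_of_not_adj (H.irrefl)

/-- The restricted adjacency matrix is the indicator. [folklore] -/
theorem adjMat_apply (i j : Λ) : adjMat H Λ i j = aind[H, i.1, j.1] := rfl

/-- Entries of `K_Λ`. [folklore] -/
theorem kmat_apply (i j : Λ) :
    K[H, Λ, x] i j = (if i = j then 1 else 0) - x * aind[H, i.1, j.1] := by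
  simp only [Matrix.sub_apply, Matrix.one_apply, Matrix.smul_apply, smul_eq_mul, adjMat_apply]

/-- Diagonal entries of `K_Λ` are `1` (no self-loops). [folklore] -/
theorem kmat_apply_self (i : Λ) : K[H, Λ, x] i i = 1 := by
  rw [kmat_apply, if_pos rfl, aind_self]; ring

/-- Off-diagonal entries of `K_Λ` are `-x·[i ∼ j]`. [folklore] -/
theorem kmat_apply_of_ne {i j : Λ} (h : i ≠ j) : K[H, Λ, x] i j = -x * aind[H, i.1, j.1] := by
  rw [kmat_apply, if_neg h]; ring

/-- `K_Λ` is symmetric. [folklore] -/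
theorem kmat_transpose : (K[H, Λ, x])ᵀ = K[H, Λ, x] := by
  ext i j
  rw [transpose_apply, kmat_apply, kmat_apply, aind_comm]
  simp only [eq_comm (a := j)]

/-- The adjugate of `K_Λ` is symmetric. [folklore] -/
theorem adjugate_kmat_symm (i j : Λ) : (K[H, Λ, x]).adjugate i j = (K[H, Λ, x]).adjugate j i := by
  rw [← transpose_apply (K[H, Λ, x]).adjugate j i, adjugate_transpose, kmat_transpose]

/-- Deleting the index `a` from `K_Λ` gives `K_{Λ ∖ a}`, up to a reindexing of the complement of
`a` in `↥Λ` by `↥(Λ.erase a)` preserving the underlying sites. [folklore] -/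
theorem exists_kmat_toSquareBlockProp {a : Site 2} (ha : a ∈ Λ) :
    ∃ e : {i : Λ // ¬ i = ⟨a, ha⟩} ≃ ↥(Λ.erase a),
      (∀ i, ((e i : ↥(Λ.erase a)) : Site 2) = (i : Λ).1) ∧
      (K[H, Λ, x]).toSquareBlockProp (fun i => ¬ i = ⟨a, ha⟩) = (K[H, Λ.erase a, x]).submatrix e e := by
  let e : {i : Λ // ¬ i = ⟨a, ha⟩} ≃ ↥(Λ.erase a) :=
    { toFun := fun i => ⟨i.1.1, mem_erase.2 ⟨fun h => i.2 (Subtype.ext h), i.1.2⟩⟩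
      invFun := fun u => ⟨⟨u.1, (mem_erase.1 u.2).2⟩, fun h => (mem_erase.1 u.2).1 (congrArg Subtype.val h)⟩
      left_inv := fun _ => rfl
      right_inv := fun _ => rfl }
  refine ⟨e, fun _ => rfl, ?_⟩
  ext i j
  simp only [toSquareBlockProp_def, of_apply, submatrix_apply, kmat_apply]
  by_cases h : (i : Λ) = (j : Λ)
  · have h' : e i = e j := by rw [Subtype.ext h]
    rw [if_pos h, if_pos h']
    rfl
  · have h' : e i ≠ e j := fun h' => h (Subtype.ext (congrArg Subtype.val h' :))
    rw [if_neg h, if_neg h']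
    rfl

/-- `adj(K_Λ)_{aa} = det K_{Λ ∖ a}`. [folklore] -/
theorem adjugate_kmat_self {a : Site 2} (ha : a ∈ Λ) :
    (K[H, Λ, x]).adjugate ⟨a, ha⟩ ⟨a, ha⟩ = (K[H, Λ.erase a, x]).det := by
  obtain ⟨e, -, he⟩ := exists_kmat_toSquareBlockProp (H := H) (x := x) ha
  rw [adjugate_diag, he, det_submatrix_equiv_self]

/-- **Laplace expansion of `det K_Λ` along the row of `v`**:
`det K_Λ = det K_{Λ∖v} - x Σ_{u ∼ v} adj(K_Λ)_{uv}`. [folklore] -/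
theorem det_kmat_eq {v : Site 2} (hv : v ∈ Λ) :
    (K[H, Λ, x]).det = (K[H, Λ.erase v, x]).det -
      x * ∑ u : Λ, aind[H, v, u.1] * (K[H, Λ, x]).adjugate u ⟨v, hv⟩ := by
  rw [det_eq_sum_mul_adjugate_row _ ⟨v, hv⟩, ← adjugate_kmat_self hv]
  simp only [kmat_apply, sub_mul, sum_sub_distrib, ite_mul, one_mul, zero_mul,
    Finset.sum_ite_eq, mem_univ, if_true, mul_sum, mul_assoc]

/-- **First-step expansion of `adj(K_Λ)_{ba}` along the deleted vertex `a`**: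
`adj(K_Λ)_{ba} = x Σ_{u ∼ a} adj(K_{Λ∖a})_{bu}`. [folklore] -/
theorem adjugate_kmat_eq {a b : Site 2} (ha : a ∈ Λ) (hb : b ∈ Λ) (hab : a ≠ b) :
    (K[H, Λ, x]).adjugate ⟨b, hb⟩ ⟨a, ha⟩ =
      x * ∑ u : ↥(Λ.erase a), aind[H, a, u.1] *
        (K[H, Λ.erase a, x]).adjugate ⟨b, mem_erase.2 ⟨hab.symm, hb⟩⟩ u := by
  have hab' : (⟨a, ha⟩ : Λ) ≠ ⟨b, hb⟩ := fun h => hab (congrArg Subtype.val h)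
  obtain ⟨e, he1, he⟩ := exists_kmat_toSquareBlockProp (H := H) (x := x) ha
  rw [adjugate_eq_neg_sum _ hab', he, adjugate_submatrix_equiv_self, ← e.sum_comp, mul_sum, ← sum_neg_distrib]
  refine Finset.sum_congr rfl fun i _ => ?_
  rw [kmat_apply_of_ne i.2, submatrix_apply, aind_comm]
  have : e ⟨⟨b, hb⟩, hab'.symm⟩ = ⟨b, mem_erase.2 ⟨hab.symm, hb⟩⟩ := Subtype.ext (he1 _)
  rw [this, he1]
  simp only [neg_mul, neg_neg, mul_assoc]

end FermionMatrix

end DetExpansion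

/-- Registered sub-goal of this helper file (stub `stub_determinantal`, file 1/5): **a diagonal
adjugate entry of `1 - xA_{H|Λ}` is the determinant on `Λ ∖ a`**. [folklore] -/
theorem adjugate_fermionMatrix_diag :
    ∀ (H : SimpleGraph (Site 2)) (Λ : Finset (Site 2)) (x : ℝ) (a : Site 2) (ha : a ∈ Λ),
      ((1 : Matrix Λ Λ ℝ) - x • adjMat H Λ).adjugate ⟨a, ha⟩ ⟨a, ha⟩ =
        ((1 : Matrix ↥(Λ.erase a) ↥(Λ.erase a) ℝ) - x • adjMat H (Λ.erase a)).det :=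
  fun _ _ _ _ ha => DetExpansion.adjugate_kmat_self ha

end Summit.CriticalPhenomena.SAWScalingLimit.Theorems.AvoidanceLimit.Anchor

end
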